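import Literature.NumberTheory.LFunctions.ConreyIwaniec2002CircleMethodDefs
import Mathlib.Analysis.SpecialFunctions.Pow.Real
import HarnessLib

/-!
# Conrey–Iwaniec (2002), §4 (4.23): the sizes `X(c²r/mX)^{5/4} ≪ q^{3/2}cCm^{-5/4}`

B. Conrey, H. Iwaniec, *Spacing of zeros of Hecke L-functions and the class number problem*,
Acta Arith. 103 (2002) 259–312, §4 (4.23) [held text `paper:arxiv-math_0111012`, p0012]: with
`C = 2√(qX)`, `1 ≤ c ≤ C`, `r = q/(c,q) ≤ q`, "`ĝ_m(α) ≪ X(c²r/mX)^{5/4} ≪ q^{3/2}cCm^{-5/4}`".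
This file (cell `landau-siegel/ls-inputs`, line `theta-circle-method`, towards the registered
stub S3c `stub_bessel_kernel`) records the elementary real inequalities behind the second `≪`,
in the normalisation `a = (4π/c)√(m/r)` of `ConreyIwaniec2002BesselKernel.lean`
(so `X(c²r/(16π²mX))^{5/4} = 1/(a²√(a√X))`):

* `inv_sq_mul_sqrt_le_target`: `1/(a²√(a√X)) ≤ q^{3/2}·c·2√(qX)·m^{-5/4}`;
* `small_le_target`: if `a√X < 2` then `X ≤ q^{3/2}·c·2√(qX)·m^{-5/4}` (the trivial bound
  suffices for small arguments);
* `four_pi_abs_mul_sqrt_le`: `|α| ≤ (cC)^{-1}` gives `4π|α|√(2X) ≤ (3/4)a` (no stationary phase).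

All by comparing fourth powers (`c⁶r⁵ ≤ 64q⁸X³`).

«The programme SEARCHES and TYPES; no claim about Landau–Siegel zeros, Theorems 1–2 of
arXiv:2211.02515 or a repaired Margin232 until a kernel theorem says so.»

## References

* [ConreyIwaniec2002] B. Conrey, H. Iwaniec, *Spacing of zeros of Hecke L-functions and the class
  number problem*, Acta Arith. 103 (2002) 259–312, arXiv:math/0111012: §4 (4.5), (4.22)–(4.24).
* G. N. Watson, *A Treatise on the Theory of Bessel Functions* (2nd ed., 1944), §7.21 (Hankel's
  expansions; here replaced by the elementary envelope built from `J₀`, `J₁`).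
-/

noncomputable section

open Real Set

namespace Literature.NumberTheory.LFunctions

namespace ConreyIwaniec2002

section Arith

/-- The fourth power of the target quantity `q^{3/2}·c·2√(qX)·m^{-5/4}`:
`(q^{3/2}c·2√(qX)·m^{-5/4})⁴ = 16q⁸c⁴X²/m⁵`. [folklore] -/
private theorem target_pow_four {q c m : ℕ} {X : ℝ} (hX : 0 ≤ X) :
    ((q : ℝ) ^ (3 / 2 : ℝ) * c * (2 * Real.sqrt (q * X)) * (m : ℝ) ^ (-(5 / 4 : ℝ))) ^ 4 =
      16 * (q : ℝ) ^ 8 * (c : ℝ) ^ 4 * X ^ 2 / (m : ℝ) ^ 5 := by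
  have hq0 : (0 : ℝ) ≤ q := Nat.cast_nonneg q
  have hm0 : (0 : ℝ) ≤ m := Nat.cast_nonneg m
  have hq4 : ((q : ℝ) ^ (3 / 2 : ℝ)) ^ 4 = (q : ℝ) ^ 6 := by
    rw [← Real.rpow_natCast _ 4, ← Real.rpow_mul hq0, show (3 / 2 : ℝ) * ((4 : ℕ) : ℝ) = ((6 : ℕ) : ℝ) by
      norm_num, Real.rpow_natCast]
  have hm4 : ((m : ℝ) ^ (-(5 / 4 : ℝ))) ^ 4 = ((m : ℝ) ^ 5)⁻¹ := by
    rw [← Real.rpow_natCast _ 4, ← Real.rpow_mul hm0,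
      show (-(5 / 4 : ℝ)) * ((4 : ℕ) : ℝ) = -((5 : ℕ) : ℝ) by norm_num, Real.rpow_neg hm0,
      Real.rpow_natCast]
  have hs4 : Real.sqrt (q * X) ^ 4 = ((q : ℝ) * X) ^ 2 := by
    rw [show (4 : ℕ) = 2 * 2 from rfl, pow_mul, Real.sq_sqrt (by positivity)]
  rw [mul_pow, mul_pow, mul_pow, hq4, hm4, mul_pow, hs4]
  ring

/-- `c ≤ 2√(qX)` gives `c⁶ ≤ 64q³X³`. [folklore] -/
private theorem pow_six_le {q c : ℕ} {X : ℝ} (hX : 0 ≤ X) (hcC : (c : ℝ) ≤ 2 * Real.sqrt (q * X)) :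
    (c : ℝ) ^ 6 ≤ 64 * (q : ℝ) ^ 3 * X ^ 3 := by
  have h2 : (c : ℝ) ^ 2 ≤ 4 * (q * X) := by
    have := pow_le_pow_left₀ (Nat.cast_nonneg c) hcC 2
    rw [mul_pow, Real.sq_sqrt (by positivity)] at this
    linarith
  calc (c : ℝ) ^ 6 = ((c : ℝ) ^ 2) ^ 3 := by ring
    _ ≤ (4 * (q * X)) ^ 3 := pow_le_pow_left₀ (by positivity) h2 3
    _ = 64 * (q : ℝ) ^ 3 * X ^ 3 := by ring

/-- With `a = (4π/c)√(m/r)`: `a²c²r = 16π²m`. [folklore] -/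
private theorem a_sq_mul {c rc m : ℕ} (hc : 1 ≤ c) (hr : 1 ≤ rc) :
    (4 * Real.pi / c * Real.sqrt (m / rc)) ^ 2 * (c : ℝ) ^ 2 * rc = 16 * Real.pi ^ 2 * m := by
  have hc0 : (c : ℝ) ≠ 0 := by positivity
  have hr0 : (rc : ℝ) ≠ 0 := by positivity
  have hsq : Real.sqrt (m / rc) ^ 2 = (m : ℝ) / rc := Real.sq_sqrt (by positivity)
  calc (4 * Real.pi / c * Real.sqrt (m / rc)) ^ 2 * (c : ℝ) ^ 2 * rc
      = 16 * Real.pi ^ 2 * (Real.sqrt (m / rc) ^ 2 * rc) * ((c : ℝ) / c) ^ 2 := by ring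
    _ = 16 * Real.pi ^ 2 * m := by rw [hsq, div_self hc0]; field_simp

/-- **The size of the main term, large arguments**: with `a = (4π/c)√(m/r)`, `1 ≤ r ≤ q`,
`1 ≤ c ≤ 2√(qX)`, `m ≥ 1`, `X ≥ 1/2`:
`1/(a²√(a√X)) = X(c²r/(16π²mX))^{5/4} ≤ q^{3/2}·c·2√(qX)·m^{-5/4}` (print: "`ĝ_m(α) ≪
X(c²r/mX)^{5/4} ≪ q^{3/2}cCm^{-5/4}`"; compare fourth powers: `c⁶r⁵ ≤ 64q⁸X³`).
[cite: ConreyIwaniec2002, §4 (4.23)] -/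
theorem inv_sq_mul_sqrt_le_target {q c rc m : ℕ} {X : ℝ} (hX : 1 / 2 ≤ X) (hc : 1 ≤ c)
    (hcC : (c : ℝ) ≤ 2 * Real.sqrt (q * X)) (hr : 1 ≤ rc) (hrq : rc ≤ q) (hm : 1 ≤ m) :
    1 / ((4 * Real.pi / c * Real.sqrt (m / rc)) ^ 2 *
        Real.sqrt ((4 * Real.pi / c * Real.sqrt (m / rc)) * Real.sqrt X)) ≤
      (q : ℝ) ^ (3 / 2 : ℝ) * c * (2 * Real.sqrt (q * X)) * (m : ℝ) ^ (-(5 / 4 : ℝ)) := by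
  set a : ℝ := 4 * Real.pi / c * Real.sqrt (m / rc) with ha
  have hX0 : 0 < X := by linarith
  have hq1 : 1 ≤ q := le_trans hr hrq
  have hqR : (1 : ℝ) ≤ q := by exact_mod_cast hq1
  have hmR : (1 : ℝ) ≤ m := by exact_mod_cast hm
  have hcR : (1 : ℝ) ≤ c := by exact_mod_cast hc
  have hrR : (1 : ℝ) ≤ rc := by exact_mod_cast hr
  have hrqR : (rc : ℝ) ≤ q := by exact_mod_cast hrq
  have hρ : 0 < Real.sqrt (m / rc) := Real.sqrt_pos.mpr (by positivity)
  have ha0 : 0 < a := by positivity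
  have hs0 : 0 < Real.sqrt X := Real.sqrt_pos.mpr hX0
  have hL0 : 0 ≤ 1 / (a ^ 2 * Real.sqrt (a * Real.sqrt X)) := by positivity
  have hR0 : 0 ≤ (q : ℝ) ^ (3 / 2 : ℝ) * c * (2 * Real.sqrt (q * X)) * (m : ℝ) ^ (-(5 / 4 : ℝ)) := by
    positivity
  rw [← pow_le_pow_iff_left₀ hL0 hR0 (by norm_num : (4 : ℕ) ≠ 0), target_pow_four hX0.le]
  -- the left fourth power
  have hs4 : Real.sqrt (a * Real.sqrt X) ^ 4 = a ^ 2 * X := by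
    rw [show (4 : ℕ) = 2 * 2 from rfl, pow_mul, Real.sq_sqrt (by positivity), mul_pow,
      Real.sq_sqrt hX0.le]
  have hL4 : (1 / (a ^ 2 * Real.sqrt (a * Real.sqrt X))) ^ 4 = 1 / (a ^ 10 * X) := by
    rw [div_pow, one_pow, mul_pow, hs4]; ring
  rw [hL4, div_le_div_iff₀ (by positivity) (by positivity), one_mul]
  -- `a¹⁰c¹⁰r⁵ = (16π²m)⁵`
  have key2 : a ^ 2 * (c : ℝ) ^ 2 * rc = 16 * Real.pi ^ 2 * m := a_sq_mul hc hr
  have key10 : a ^ 10 * (c : ℝ) ^ 10 * (rc : ℝ) ^ 5 = (16 * Real.pi ^ 2 * m) ^ 5 := by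
    rw [← key2]; ring
  have hc6 : (c : ℝ) ^ 6 ≤ 64 * (q : ℝ) ^ 3 * X ^ 3 := pow_six_le hX0.le hcC
  have hr5 : (rc : ℝ) ^ 5 ≤ (q : ℝ) ^ 5 := pow_le_pow_left₀ (by positivity) hrqR 5
  have hc0 : (c : ℝ) ≠ 0 := by positivity
  have hr0 : (rc : ℝ) ≠ 0 := by positivity
  have e : 16 * (q : ℝ) ^ 8 * (c : ℝ) ^ 4 * X ^ 2 * (a ^ 10 * X) =
      16 * (q : ℝ) ^ 8 * X ^ 3 * (a ^ 10 * (c : ℝ) ^ 10 * (rc : ℝ) ^ 5) / ((c : ℝ) ^ 6 * (rc : ℝ) ^ 5) := by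
    field_simp
  rw [e, key10, le_div_iff₀ (by positivity)]
  have hπ : (64 : ℝ) ≤ (16 * Real.pi ^ 2) ^ 5 := by
    have h1 : (1 : ℝ) ≤ 16 * Real.pi ^ 2 := by nlinarith [Real.pi_gt_three]
    have h2 : 16 * Real.pi ^ 2 ≤ (16 * Real.pi ^ 2) ^ 5 := le_self_pow₀ h1 (by norm_num)
    nlinarith [Real.pi_gt_three]
  have hA : 0 ≤ (q : ℝ) ^ 8 * X ^ 3 * (m : ℝ) ^ 5 := by positivity
  calc (m : ℝ) ^ 5 * ((c : ℝ) ^ 6 * (rc : ℝ) ^ 5) ≤ (m : ℝ) ^ 5 * (64 * (q : ℝ) ^ 3 * X ^ 3 * (q : ℝ) ^ 5) := by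
        gcongr
    _ = 64 * ((q : ℝ) ^ 8 * X ^ 3 * (m : ℝ) ^ 5) := by ring
    _ ≤ 16 * (16 * Real.pi ^ 2) ^ 5 * ((q : ℝ) ^ 8 * X ^ 3 * (m : ℝ) ^ 5) := by
        apply mul_le_mul_of_nonneg_right _ hA
        linarith
    _ = 16 * (q : ℝ) ^ 8 * X ^ 3 * ((16 * Real.pi ^ 2 * m) ^ 5) := by ring

/-- **Small arguments**: if moreover `a√X < 2`, then already the trivial bound `X` is
`≤ q^{3/2}·c·2√(qX)·m^{-5/4}` (`mX < c²r/36`, fourth powers). [cite: ConreyIwaniec2002, §4 (4.23)] -/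
theorem small_le_target {q c rc m : ℕ} {X : ℝ} (hX : 1 / 2 ≤ X) (hc : 1 ≤ c)
    (hcC : (c : ℝ) ≤ 2 * Real.sqrt (q * X)) (hr : 1 ≤ rc) (hrq : rc ≤ q) (hm : 1 ≤ m)
    (hsmall : 4 * Real.pi / c * Real.sqrt (m / rc) * Real.sqrt X < 2) :
    X ≤ (q : ℝ) ^ (3 / 2 : ℝ) * c * (2 * Real.sqrt (q * X)) * (m : ℝ) ^ (-(5 / 4 : ℝ)) := by
  set a : ℝ := 4 * Real.pi / c * Real.sqrt (m / rc) with ha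
  have hX0 : 0 < X := by linarith
  have hq1 : 1 ≤ q := le_trans hr hrq
  have hqR : (1 : ℝ) ≤ q := by exact_mod_cast hq1
  have hmR : (1 : ℝ) ≤ m := by exact_mod_cast hm
  have hcR : (1 : ℝ) ≤ c := by exact_mod_cast hc
  have hrR : (1 : ℝ) ≤ rc := by exact_mod_cast hr
  have hrqR : (rc : ℝ) ≤ q := by exact_mod_cast hrq
  have hρ : 0 < Real.sqrt (m / rc) := Real.sqrt_pos.mpr (by positivity)
  have ha0 : 0 < a := by positivity
  have hs0 : 0 < Real.sqrt X := Real.sqrt_pos.mpr hX0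
  have hR0 : 0 ≤ (q : ℝ) ^ (3 / 2 : ℝ) * c * (2 * Real.sqrt (q * X)) * (m : ℝ) ^ (-(5 / 4 : ℝ)) := by
    positivity
  rw [← pow_le_pow_iff_left₀ hX0.le hR0 (by norm_num : (4 : ℕ) ≠ 0), target_pow_four hX0.le,
    le_div_iff₀ (by positivity)]
  -- `36 m X ≤ c² r`
  have key2 : a ^ 2 * (c : ℝ) ^ 2 * rc = 16 * Real.pi ^ 2 * m := a_sq_mul hc hr
  have haX : a ^ 2 * X < 4 := by
    have h1 : (a * Real.sqrt X) ^ 2 < 2 ^ 2 := by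
      exact pow_lt_pow_left₀ hsmall (by positivity) (by norm_num)
    rw [mul_pow, Real.sq_sqrt hX0.le] at h1
    linarith
  have hmX : 36 * ((m : ℝ) * X) ≤ (c : ℝ) ^ 2 * rc := by
    have h1 : a ^ 2 * X * ((c : ℝ) ^ 2 * rc) ≤ 4 * ((c : ℝ) ^ 2 * rc) :=
      mul_le_mul_of_nonneg_right haX.le (by positivity)
    have h2 : a ^ 2 * X * ((c : ℝ) ^ 2 * rc) = 16 * Real.pi ^ 2 * m * X := by
      rw [← key2]; ring
    have h3 : 9 * ((m : ℝ) * X) ≤ Real.pi ^ 2 * (m * X) := by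
      apply mul_le_mul_of_nonneg_right _ (by positivity)
      nlinarith [Real.pi_gt_three]
    nlinarith
  have h5 : (36 * ((m : ℝ) * X)) ^ 5 ≤ ((c : ℝ) ^ 2 * rc) ^ 5 :=
    pow_le_pow_left₀ (by positivity) hmX 5
  have hc6 : (c : ℝ) ^ 6 ≤ 64 * (q : ℝ) ^ 3 * X ^ 3 := pow_six_le hX0.le hcC
  have hr5 : (rc : ℝ) ^ 5 ≤ (q : ℝ) ^ 5 := pow_le_pow_left₀ (by positivity) hrqR 5
  have e : X ^ 4 * (m : ℝ) ^ 5 = (36 * ((m : ℝ) * X)) ^ 5 / (36 ^ 5 * X) := by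
    field_simp
  rw [e, div_le_iff₀ (by positivity)]
  have hA : 0 ≤ (c : ℝ) ^ 4 * (q : ℝ) ^ 8 * X ^ 3 := by positivity
  calc (36 * ((m : ℝ) * X)) ^ 5 ≤ ((c : ℝ) ^ 2 * rc) ^ 5 := h5
    _ = (c : ℝ) ^ 4 * ((c : ℝ) ^ 6 * (rc : ℝ) ^ 5) := by ring
    _ ≤ (c : ℝ) ^ 4 * (64 * (q : ℝ) ^ 3 * X ^ 3 * (q : ℝ) ^ 5) := by gcongr
    _ = 64 * ((c : ℝ) ^ 4 * (q : ℝ) ^ 8 * X ^ 3) := by ring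
    _ ≤ 16 * 36 ^ 5 * ((c : ℝ) ^ 4 * (q : ℝ) ^ 8 * X ^ 3) :=
        mul_le_mul_of_nonneg_right (by norm_num) hA
    _ = 16 * (q : ℝ) ^ 8 * (c : ℝ) ^ 4 * X ^ 2 * (36 ^ 5 * X) := by ring

/-- **No stationary phase**: `|α| ≤ (cC)^{-1}`, `C = 2√(qX)`, `r ≤ q`, `m ≥ 1` give
`4π|α|√(2X) ≤ 2√2π/(c√q) ≤ (3/4)·(4π/c)√(m/r)` (print: "`|α|cC ≤ 1`, so no stationary phase").
[cite: ConreyIwaniec2002, §4 (4.23)] -/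
theorem four_pi_abs_mul_sqrt_le {q c rc m : ℕ} {X α : ℝ} (hX : 0 < X) (hc : 1 ≤ c)
    (hr : 1 ≤ rc) (hrq : rc ≤ q) (hm : 1 ≤ m)
    (hα : |α| ≤ 1 / (c * (2 * Real.sqrt (q * X)))) :
    4 * Real.pi * |α| * Real.sqrt (2 * X) ≤ 3 / 4 * (4 * Real.pi / c * Real.sqrt (m / rc)) := by
  have hq1 : 1 ≤ q := le_trans hr hrq
  have hqR : (1 : ℝ) ≤ q := by exact_mod_cast hq1
  have hmR : (1 : ℝ) ≤ m := by exact_mod_cast hm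
  have hcR : (1 : ℝ) ≤ c := by exact_mod_cast hc
  have hrR : (1 : ℝ) ≤ rc := by exact_mod_cast hr
  have hrqR : (rc : ℝ) ≤ q := by exact_mod_cast hrq
  have hs0 : 0 < Real.sqrt X := Real.sqrt_pos.mpr hX
  have hsq : 0 < Real.sqrt q := Real.sqrt_pos.mpr (by positivity)
  have hqX : Real.sqrt (q * X) = Real.sqrt q * Real.sqrt X := Real.sqrt_mul (by positivity) X
  have h2X : Real.sqrt (2 * X) = Real.sqrt 2 * Real.sqrt X := Real.sqrt_mul (by norm_num) X
  have hc0 : (0 : ℝ) < c := by positivity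
  -- left side
  have hL : 4 * Real.pi * |α| * Real.sqrt (2 * X) ≤ 2 * Real.sqrt 2 * Real.pi / (c * Real.sqrt q) := by
    calc 4 * Real.pi * |α| * Real.sqrt (2 * X)
        = (4 * Real.pi * Real.sqrt (2 * X)) * |α| := by ring
      _ ≤ (4 * Real.pi * Real.sqrt (2 * X)) * (1 / (c * (2 * Real.sqrt (q * X)))) :=
          mul_le_mul_of_nonneg_left hα (by positivity)
      _ = 2 * Real.sqrt 2 * Real.pi / (c * Real.sqrt q) := by
          rw [hqX, h2X]
          field_simp
          ring
  -- right side
  have hρ : 1 / Real.sqrt q ≤ Real.sqrt (m / rc) := by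
    have e1 : 1 / Real.sqrt q = Real.sqrt (1 / q) := by
      rw [Real.sqrt_div' _ (by positivity), Real.sqrt_one]
    rw [e1]
    refine Real.sqrt_le_sqrt ?_
    rw [div_le_div_iff₀ (by positivity) (by positivity)]
    nlinarith
  have hR : 3 * Real.pi / (c * Real.sqrt q) ≤ 3 / 4 * (4 * Real.pi / c * Real.sqrt (m / rc)) := by
    calc 3 * Real.pi / (c * Real.sqrt q) = 3 * Real.pi / c * (1 / Real.sqrt q) := by
          field_simp
      _ ≤ 3 * Real.pi / c * Real.sqrt (m / rc) := mul_le_mul_of_nonneg_left hρ (by positivity)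
      _ = 3 / 4 * (4 * Real.pi / c * Real.sqrt (m / rc)) := by ring
  -- `2√2 ≤ 3`
  have h22 : Real.sqrt 2 ≤ 3 / 2 := by
    have h : Real.sqrt 2 ≤ Real.sqrt ((3 / 2) ^ 2) := Real.sqrt_le_sqrt (by norm_num)
    rwa [Real.sqrt_sq (by norm_num)] at h
  have hmid : 2 * Real.sqrt 2 * Real.pi / (c * Real.sqrt q) ≤ 3 * Real.pi / (c * Real.sqrt q) := by
    apply div_le_div_of_nonneg_right _ (by positivity)
    nlinarith [Real.pi_pos]
  exact hL.trans (hmid.trans hR)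

end Arith

end ConreyIwaniec2002

end Literature.NumberTheory.LFunctions

end
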